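import Mathlib
import Summits.ValiantsHypothesis.ValiantsHypothesis.Theorems.RigidityForcesSymmetryRankRigidMinimalReprLaplaceFourDefs

/-!
# Contracting two slots of a split-rank-one decomposition of `P₄`
# (crux `RankRigidMinimalRepr`, stmt-ValiantsHypothesis-18034, route `RigidityForcesSymmetry`)

The engine of the exact analysis of `LaplaceOptimal 4` (`…LaplaceFourDefs.lean`, `…LaplaceFourPencil.lean`).  Pair slot
`0` with `ψ ∈ ℂ⁴` and slot `1` with `φ ∈ ℂ⁴` (`contract₀₁`); then

* the pattern gives the symmetric zero-diagonal matrix `Q_{ψ,φ}(z,w) = Σ_{x,y distinct, ∉ {z,w}} ψ_x φ_y`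
  (`contract_permPattern`), and `Q_{t,𝟙} = pencil t` (`contract_permPattern_one`);
* a split term `u(v|_S) w(v|_{Sᶜ})` becomes, according to `S` (up to complement, `isSplitTerm_compl`):
  `S = {0}`, `{0,1}` — NOISE killed by one linear condition on `ψ` (`contract_term_0`, `contract_term_01`);
  `S = {1}` — noise killed by a condition on `φ` (`contract_term_1`);
  `S = {2}`, `{3}` — a rank-one matrix with a FIXED column resp. row (`contract_term_2`, `contract_term_3`);
  `S = {0,2}` — rank one, column linear in `ψ`, row linear in `φ` (`contract_term_02`);
  `S = {0,3}` — rank one, column linear in `φ`, row linear in `ψ` (`contract_term_03`);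
* relabelling the slots (`slotPerm`) preserves the pattern and sends a term across `S` to a term across `σ⁻¹ S`
  (`slotPerm_permPattern`, `isSplitTerm_slotPerm`), so any two slots can be brought to positions `0, 1`.

HONEST FRAMING: bookkeeping toward the finite statement `LaplaceOptimal 4` (rung `TiedTorusBound 3`); the crux stays OPEN;
nothing here bears on `VP ≠ VNP`.
-/

set_option autoImplicit false

-- the mandated summit-side namespace repeats a component by design (single-problem summit)
set_option linter.dupNamespace false

namespace Summit.ValiantsHypothesis.ValiantsHypothesis.Theorems.RigidityForcesSymmetryRankRigidMinimalRepr


namespace LaplaceFourContraction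

open Finset Matrix

/-! ### §1 The contracted pattern -/

/-- A vector of four values is injective iff the values are pairwise distinct. -/
theorem injective_vec4_iff (x y z w : Fin 4) :
    Function.Injective ![x, y, z, w] ↔ (x ≠ y ∧ x ≠ z ∧ x ≠ w ∧ y ≠ z ∧ y ≠ w ∧ z ≠ w) := by
  constructor
  · intro h
    refine ⟨fun e => ?_, fun e => ?_, fun e => ?_, fun e => ?_, fun e => ?_, fun e => ?_⟩
    · exact absurd (@h 0 1 (by simp [e])) (by decide)
    · exact absurd (@h 0 2 (by simp [e])) (by decide)
    · exact absurd (@h 0 3 (by simp [e])) (by decide)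
    · exact absurd (@h 1 2 (by simp [e])) (by decide)
    · exact absurd (@h 1 3 (by simp [e])) (by decide)
    · exact absurd (@h 2 3 (by simp [e])) (by decide)
  · rintro ⟨h01, h02, h03, h12, h13, h23⟩ i j hij
    fin_cases i <;> fin_cases j <;> first | rfl | (exfalso; simp_all)

/-- The contracted pattern: `Q_{ψ,φ}(z,w) = Σ ψ_x φ_y` over `x ≠ y` both outside `{z,w}`, and `0` on the diagonal. -/
theorem contract_permPattern (ψ φ : Fin 4 → ℂ) (z w : Fin 4) :
    contract₀₁ permPattern₄ ψ φ z w =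
      if z = w then 0 else ∑ x, ∑ y, (if x ≠ y ∧ x ≠ z ∧ x ≠ w ∧ y ≠ z ∧ y ≠ w then ψ x * φ y else 0) := by
  simp only [contract₀₁, Matrix.of_apply, permPattern₄]
  by_cases hzw : z = w
  · rw [if_pos hzw]
    apply Finset.sum_eq_zero; intro x _; apply Finset.sum_eq_zero; intro y _
    rw [if_neg, mul_zero]
    rw [injective_vec4_iff]; tauto
  · rw [if_neg hzw]
    apply Finset.sum_congr rfl; intro x _; apply Finset.sum_congr rfl; intro y _
    by_cases hc : x ≠ y ∧ x ≠ z ∧ x ≠ w ∧ y ≠ z ∧ y ≠ w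
    · rw [if_pos hc, if_pos, mul_one]
      rw [injective_vec4_iff]; tauto
    · rw [if_neg hc, if_neg, mul_zero]
      rw [injective_vec4_iff]; tauto

/-- Explicit entries: `Q_{ψ,φ}(z,w) = ψ_x φ_y + ψ_y φ_x` with `{x,y}` the complement of `{z,w}` (all sixteen entries). -/
theorem contract_permPattern_entries (ψ φ : Fin 4 → ℂ) :
    contract₀₁ permPattern₄ ψ φ = !![0, ψ 2 * φ 3 + ψ 3 * φ 2, ψ 1 * φ 3 + ψ 3 * φ 1, ψ 1 * φ 2 + ψ 2 * φ 1;
      ψ 2 * φ 3 + ψ 3 * φ 2, 0, ψ 0 * φ 3 + ψ 3 * φ 0, ψ 0 * φ 2 + ψ 2 * φ 0;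
      ψ 1 * φ 3 + ψ 3 * φ 1, ψ 0 * φ 3 + ψ 3 * φ 0, 0, ψ 0 * φ 1 + ψ 1 * φ 0;
      ψ 1 * φ 2 + ψ 2 * φ 1, ψ 0 * φ 2 + ψ 2 * φ 0, ψ 0 * φ 1 + ψ 1 * φ 0, 0] := by
  ext z w
  rw [contract_permPattern]
  fin_cases z <;> fin_cases w <;> simp [Fin.sum_univ_four, mul_comm, add_comm]

/-- `Q` is symmetric in `ψ, φ`. -/
theorem contract_permPattern_swap (ψ φ : Fin 4 → ℂ) :
    contract₀₁ permPattern₄ φ ψ = contract₀₁ permPattern₄ ψ φ := by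
  rw [contract_permPattern_entries, contract_permPattern_entries]
  ext z w; fin_cases z <;> fin_cases w <;> simp [mul_comm, add_comm]

/-- `Q_{t,𝟙}` is the pencil `M(t)`. -/
theorem contract_permPattern_one (t : Fin 4 → ℂ) : contract₀₁ permPattern₄ t 1 = pencil t := by
  rw [contract_permPattern_entries]
  ext z w
  simp only [pencil, Matrix.of_apply, Fin.sum_univ_four]
  fin_cases z <;> fin_cases w <;> simp <;> ring

/-- `Q_{ψ,φ}` is additive and homogeneous in `ψ` (so kernels of linear conditions on `ψ` can be exploited). -/
theorem contract_permPattern_add_smul (ψ ψ' φ : Fin 4 → ℂ) (μ : ℂ) :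
    contract₀₁ permPattern₄ (ψ + μ • ψ') φ = contract₀₁ permPattern₄ ψ φ + μ • contract₀₁ permPattern₄ ψ' φ := by
  rw [contract_permPattern_entries, contract_permPattern_entries, contract_permPattern_entries]
  ext z w; fin_cases z <;> fin_cases w <;> simp <;> ring

/-! ### §2 Linearity of the contraction and relabelling of slots -/

/-- Contraction of a finite sum of tensors. -/
theorem contract_sum {ι : Type*} (s : Finset ι) (Y : ι → (Fin 4 → Fin 4) → ℂ) (ψ φ : Fin 4 → ℂ) :
    contract₀₁ (fun v => ∑ k ∈ s, Y k v) ψ φ = ∑ k ∈ s, contract₀₁ (Y k) ψ φ := by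
  ext z w
  simp only [contract₀₁, Matrix.of_apply, Matrix.sum_apply, Finset.mul_sum]
  calc (∑ x, ∑ y, ∑ k ∈ s, ψ x * φ y * Y k ![x, y, z, w])
      = ∑ x, ∑ k ∈ s, ∑ y, ψ x * φ y * Y k ![x, y, z, w] :=
        Finset.sum_congr rfl fun x _ => Finset.sum_comm
    _ = ∑ k ∈ s, ∑ x, ∑ y, ψ x * φ y * Y k ![x, y, z, w] := Finset.sum_comm

/-- Contraction only sees the values of the tensor. -/
theorem contract_congr {X Y : (Fin 4 → Fin 4) → ℂ} (h : ∀ v, X v = Y v) (ψ φ : Fin 4 → ℂ) :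
    contract₀₁ X ψ φ = contract₀₁ Y ψ φ := by
  ext z w; simp only [contract₀₁, Matrix.of_apply, h]

/-- The pattern is invariant under relabelling the slots. -/
theorem slotPerm_permPattern (σ : Equiv.Perm (Fin 4)) : slotPerm σ permPattern₄ = permPattern₄ := by
  funext v
  simp only [slotPerm, permPattern₄]
  have : Function.Injective (v ∘ σ) ↔ Function.Injective v :=
    ⟨fun h => by simpa [Function.comp_assoc] using h.comp σ.symm.injective, fun h => h.comp σ.injective⟩
  rw [if_congr this rfl rfl]

/-- Relabelling a product of tensors. -/
theorem slotPerm_mul (σ : Equiv.Perm (Fin 4)) (u w : (Fin 4 → Fin 4) → ℂ) :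
    slotPerm σ (fun v => u v * w v) = fun v => slotPerm σ u v * slotPerm σ w v := rfl

/-- Relabelling a sum of tensors. -/
theorem slotPerm_sum {ι : Type*} (σ : Equiv.Perm (Fin 4)) (s : Finset ι) (Y : ι → (Fin 4 → Fin 4) → ℂ) :
    slotPerm σ (fun v => ∑ k ∈ s, Y k v) = fun v => ∑ k ∈ s, slotPerm σ (Y k) v := rfl

/-- Dependence sets move by `σ⁻¹` under relabelling: if `u` depends only on `v|_S` then `v ↦ u(v ∘ σ)` depends only on
`v|_{σ '' S}` = the preimage of `S` under `σ⁻¹`. -/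
theorem dependsOnlyOn_slotPerm (σ : Equiv.Perm (Fin 4)) {S : Finset (Fin 4)} {u : (Fin 4 → Fin 4) → ℂ}
    (hu : DependsOnlyOn S u) : DependsOnlyOn (S.map σ.toEmbedding) (slotPerm σ u) := by
  intro v v' h
  apply hu
  intro i hi
  exact h (σ i) (Finset.mem_map_of_mem _ hi)

/-- The complement of a relabelled set. -/
theorem compl_map_perm (σ : Equiv.Perm (Fin 4)) (S : Finset (Fin 4)) :
    (S.map σ.toEmbedding)ᶜ = Sᶜ.map σ.toEmbedding := by
  ext i
  simp only [Finset.mem_compl, Finset.mem_map_equiv]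

/-- A split term across `S` relabels to a split term across `σ(S)` (as a set of new slot positions). -/
theorem isSplitTerm_slotPerm (σ : Equiv.Perm (Fin 4)) {S : Finset (Fin 4)} {X : (Fin 4 → Fin 4) → ℂ}
    (hX : IsSplitTerm S X) : IsSplitTerm (S.map σ.toEmbedding) (slotPerm σ X) := by
  obtain ⟨u, w, hu, hw, hX⟩ := hX
  refine ⟨slotPerm σ u, slotPerm σ w, dependsOnlyOn_slotPerm σ hu, ?_, fun v => ?_⟩
  · rw [compl_map_perm]; exact dependsOnlyOn_slotPerm σ hw
  · simp only [slotPerm, hX]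

/-- Swapping the two factors: a term across `S` is a term across `Sᶜ`. -/
theorem isSplitTerm_compl {S : Finset (Fin 4)} {X : (Fin 4 → Fin 4) → ℂ} (hX : IsSplitTerm S X) :
    IsSplitTerm Sᶜ X := by
  obtain ⟨u, w, hu, hw, hX⟩ := hX
  exact ⟨w, u, hw, by rw [compl_compl]; exact hu, fun v => by rw [hX v, mul_comm]⟩


/-! ### §3 What a single split term becomes -/

section Terms

variable {u w : (Fin 4 → Fin 4) → ℂ}

/-- `S = {0}`: NOISE, killed by one linear condition on `ψ` — `(Σ_x u(x) ψ_x) · N(φ)`. -/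
theorem contract_term_0 (hu : DependsOnlyOn {0} u) (hw : DependsOnlyOn {0}ᶜ w) (φ : Fin 4 → ℂ) :
    ∃ (ℓ : Fin 4 → ℂ) (N : Matrix (Fin 4) (Fin 4) ℂ), ∀ ψ : Fin 4 → ℂ,
      contract₀₁ (fun v => u v * w v) ψ φ = (∑ x, ℓ x * ψ x) • N := by
  refine ⟨fun x => u ![x, 0, 0, 0], Matrix.of fun i j => ∑ y, φ y * w ![0, y, i, j], fun ψ => ?_⟩
  ext i j
  simp only [contract₀₁, Matrix.of_apply, Matrix.smul_apply, smul_eq_mul]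
  have hu' : ∀ x y, u ![x, y, i, j] = u ![x, 0, 0, 0] := fun x y =>
    hu _ _ (fun k hk => by fin_cases k <;> simp at hk ⊢)
  have hw' : ∀ x y, w ![x, y, i, j] = w ![0, y, i, j] := fun x y =>
    hw _ _ (fun k hk => by fin_cases k <;> simp at hk ⊢)
  simp_rw [hu', hw']
  rw [Finset.sum_mul]
  refine Finset.sum_congr rfl fun x _ => ?_
  rw [Finset.mul_sum]
  exact Finset.sum_congr rfl fun y _ => by ring

/-- `S = {1}`: noise killed by one linear condition on `φ` — `(Σ_y u(y) φ_y) · N(ψ)`. -/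
theorem contract_term_1 (hu : DependsOnlyOn {1} u) (hw : DependsOnlyOn {1}ᶜ w) (ψ : Fin 4 → ℂ) :
    ∃ (ℓ : Fin 4 → ℂ) (N : Matrix (Fin 4) (Fin 4) ℂ), ∀ φ : Fin 4 → ℂ,
      contract₀₁ (fun v => u v * w v) ψ φ = (∑ y, ℓ y * φ y) • N := by
  refine ⟨fun y => u ![0, y, 0, 0], Matrix.of fun i j => ∑ x, ψ x * w ![x, 0, i, j], fun φ => ?_⟩
  ext i j
  simp only [contract₀₁, Matrix.of_apply, Matrix.smul_apply, smul_eq_mul]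
  have hu' : ∀ x y, u ![x, y, i, j] = u ![0, y, 0, 0] := fun x y =>
    hu _ _ (fun k hk => by fin_cases k <;> simp at hk ⊢)
  have hw' : ∀ x y, w ![x, y, i, j] = w ![x, 0, i, j] := fun x y =>
    hw _ _ (fun k hk => by fin_cases k <;> simp at hk ⊢)
  simp_rw [hu', hw']
  rw [Finset.sum_comm, Finset.sum_mul]
  refine Finset.sum_congr rfl fun y _ => ?_
  rw [Finset.mul_sum]
  exact Finset.sum_congr rfl fun x _ => by ring

/-- `S = {0,1}`: noise with a fixed matrix — `(Σ_{x,y} u(x,y) ψ_x φ_y) · N`. -/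
theorem contract_term_01 (hu : DependsOnlyOn {0, 1} u) (hw : DependsOnlyOn {0, 1}ᶜ w) :
    ∃ (g : Fin 4 → Fin 4 → ℂ) (N : Matrix (Fin 4) (Fin 4) ℂ), ∀ ψ φ : Fin 4 → ℂ,
      contract₀₁ (fun v => u v * w v) ψ φ = (∑ x, ∑ y, ψ x * φ y * g x y) • N := by
  refine ⟨fun x y => u ![x, y, 0, 0], Matrix.of fun i j => w ![0, 0, i, j], fun ψ φ => ?_⟩
  ext i j
  simp only [contract₀₁, Matrix.of_apply, Matrix.smul_apply, smul_eq_mul]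
  have hu' : ∀ x y, u ![x, y, i, j] = u ![x, y, 0, 0] := fun x y =>
    hu _ _ (fun k hk => by fin_cases k <;> simp at hk ⊢)
  have hw' : ∀ x y, w ![x, y, i, j] = w ![0, 0, i, j] := fun x y =>
    hw _ _ (fun k hk => by fin_cases k <;> simp at hk ⊢)
  simp_rw [hu', hw']
  rw [Finset.sum_mul]
  refine Finset.sum_congr rfl fun x _ => ?_
  rw [Finset.sum_mul]
  exact Finset.sum_congr rfl fun y _ => by ring

/-- `S = {2}`: RANK ONE with a fixed column — `u ⊗ r(ψ,φ)`. -/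
theorem contract_term_2 (hu : DependsOnlyOn {2} u) (hw : DependsOnlyOn {2}ᶜ w) :
    ∃ f : Fin 4 → ℂ, ∀ ψ φ : Fin 4 → ℂ, ∃ r : Fin 4 → ℂ,
      contract₀₁ (fun v => u v * w v) ψ φ = Matrix.vecMulVec f r := by
  refine ⟨fun i => u ![0, 0, i, 0], fun ψ φ => ⟨fun j => ∑ x, ∑ y, ψ x * φ y * w ![x, y, 0, j], ?_⟩⟩
  ext i j
  simp only [contract₀₁, Matrix.of_apply, Matrix.vecMulVec_apply]
  have hu' : ∀ x y, u ![x, y, i, j] = u ![0, 0, i, 0] := fun x y =>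
    hu _ _ (fun k hk => by fin_cases k <;> simp at hk ⊢)
  have hw' : ∀ x y, w ![x, y, i, j] = w ![x, y, 0, j] := fun x y =>
    hw _ _ (fun k hk => by fin_cases k <;> simp at hk ⊢)
  simp_rw [hu', hw']
  rw [Finset.mul_sum]
  refine Finset.sum_congr rfl fun x _ => ?_
  rw [Finset.mul_sum]
  exact Finset.sum_congr rfl fun y _ => by ring

/-- `S = {3}`: rank one with a fixed row — `c(ψ,φ) ⊗ u`. -/
theorem contract_term_3 (hu : DependsOnlyOn {3} u) (hw : DependsOnlyOn {3}ᶜ w) :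
    ∃ f : Fin 4 → ℂ, ∀ ψ φ : Fin 4 → ℂ, ∃ c : Fin 4 → ℂ,
      contract₀₁ (fun v => u v * w v) ψ φ = Matrix.vecMulVec c f := by
  refine ⟨fun j => u ![0, 0, 0, j], fun ψ φ => ⟨fun i => ∑ x, ∑ y, ψ x * φ y * w ![x, y, i, 0], ?_⟩⟩
  ext i j
  simp only [contract₀₁, Matrix.of_apply, Matrix.vecMulVec_apply]
  have hu' : ∀ x y, u ![x, y, i, j] = u ![0, 0, 0, j] := fun x y =>
    hu _ _ (fun k hk => by fin_cases k <;> simp at hk ⊢)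
  have hw' : ∀ x y, w ![x, y, i, j] = w ![x, y, i, 0] := fun x y =>
    hw _ _ (fun k hk => by fin_cases k <;> simp at hk ⊢)
  simp_rw [hu', hw']
  rw [Finset.sum_mul]
  refine Finset.sum_congr rfl fun x _ => ?_
  rw [Finset.sum_mul]
  exact Finset.sum_congr rfl fun y _ => by ring

/-- `S = {0,2}` (matching `02|13`): rank one, column linear in `ψ`, row linear in `φ`. -/
theorem contract_term_02 (hu : DependsOnlyOn {0, 2} u) (hw : DependsOnlyOn {0, 2}ᶜ w) :
    ∃ b b' : Fin 4 → Fin 4 → ℂ, ∀ ψ φ : Fin 4 → ℂ,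
      contract₀₁ (fun v => u v * w v) ψ φ =
        Matrix.vecMulVec (fun i => ∑ x, ψ x * b x i) (fun j => ∑ y, φ y * b' y j) := by
  refine ⟨fun x i => u ![x, 0, i, 0], fun y j => w ![0, y, 0, j], fun ψ φ => ?_⟩
  ext i j
  simp only [contract₀₁, Matrix.of_apply, Matrix.vecMulVec_apply]
  have hu' : ∀ x y, u ![x, y, i, j] = u ![x, 0, i, 0] := fun x y =>
    hu _ _ (fun k hk => by fin_cases k <;> simp at hk ⊢)
  have hw' : ∀ x y, w ![x, y, i, j] = w ![0, y, 0, j] := fun x y =>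
    hw _ _ (fun k hk => by fin_cases k <;> simp at hk ⊢)
  simp_rw [hu', hw']
  rw [Finset.sum_mul]
  refine Finset.sum_congr rfl fun x _ => ?_
  rw [Finset.mul_sum]
  exact Finset.sum_congr rfl fun y _ => by ring

/-- `S = {0,3}` (matching `03|12`): rank one, column linear in `φ`, row linear in `ψ`. -/
theorem contract_term_03 (hu : DependsOnlyOn {0, 3} u) (hw : DependsOnlyOn {0, 3}ᶜ w) :
    ∃ c c' : Fin 4 → Fin 4 → ℂ, ∀ ψ φ : Fin 4 → ℂ,
      contract₀₁ (fun v => u v * w v) ψ φ =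
        Matrix.vecMulVec (fun i => ∑ y, φ y * c' y i) (fun j => ∑ x, ψ x * c x j) := by
  refine ⟨fun x j => u ![x, 0, 0, j], fun y i => w ![0, y, i, 0], fun ψ φ => ?_⟩
  ext i j
  simp only [contract₀₁, Matrix.of_apply, Matrix.vecMulVec_apply]
  have hu' : ∀ x y, u ![x, y, i, j] = u ![x, 0, 0, j] := fun x y =>
    hu _ _ (fun k hk => by fin_cases k <;> simp at hk ⊢)
  have hw' : ∀ x y, w ![x, y, i, j] = w ![0, y, i, 0] := fun x y =>
    hw _ _ (fun k hk => by fin_cases k <;> simp at hk ⊢)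
  simp_rw [hu', hw']
  rw [Finset.sum_comm, Finset.sum_mul]
  refine Finset.sum_congr rfl fun y _ => ?_
  rw [Finset.mul_sum]
  exact Finset.sum_congr rfl fun x _ => by ring

end Terms

end LaplaceFourContraction

end Summit.ValiantsHypothesis.ValiantsHypothesis.Theorems.RigidityForcesSymmetryRankRigidMinimalRepr
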